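/-
Copyright: the b2b-balaban cell (near-miss cell 7), T⁴-continuum CRUX team (coordinator ruling e34b3e0c item (2)),
seat t4-ne7b-formalise-leaf-06 (gen 28). Released under the licence of the surrounding project.
-/
import Summits.QuantumFields.BalabanUV.T4Continuum.Spine.NE7b.CovariantMeanValueInequality
import Summits.QuantumFields.BalabanUV.T4Continuum.Spine.NE7b.LatticeSubsolutionBarrier

/-!
# PH-k assembled: the approximate maximum principle for the sine-curvature of an `SU(2)` configuration critical on a
# free region (route NE7b R-H, `t4/ROUTES-NE7b.md` v5 §2 PH-k (β₄)+(γ); PRICING-NE7b v5 F23∕F23c)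

Cell `pub-balaban`, sub-cell `t4`, spine estimate NE7b (node U5c), candidate route R-H «Peierls healing map», lemma PH-k.
ROUTES-NE7b v5 §2 (γ), verbatim: «BARRIER ⇒ APPROXIMATE MAXIMUM PRINCIPLE [K once (β₄) is granted …]: if
`2d·s(x) ≤ Σ_{λ,±} s(x ± e_λ) + κ` on a finite `I`, then … `s(x₀) ≤ max_{∂I} s + (κ∕2d)·max_{∂I}|x − x₀|²` … Net:
`sup_I s ≤ max_{∂I} s + C_d·m²·D²`, `D` in fine-lattice units, `m` = sup of `s` over `I` and the 2-neighbourhood of `∂I`.»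
and §3: «(T-k0)–(T-k3) assemble (β)+(γ) in the tree up to the covariant bookkeeping constant `C′_d` of (β₄)».

With (β₄) now in the kernel (`CovariantMeanValueInequality.meanValue_inequality`, `C′_d ≤ 232(d−2)`) and (γ) landed
(`LatticeSubsolutionBarrier.barrier_subsolution{,_le}`, p252732), THIS FILE IS THE ASSEMBLY — PH-k as ONE kernel theorem
about ONE unit-quaternion lattice configuration `U : ZdGaugeConfig d (Metric.sphere (0 : ℍ) 1)`, for a fixed orientation
pair `(i, j)` and a finite set `I ⊂ ℤ^d` of base points:

* **`sineCurvature_subsolution`** — on `I`, `s(x) := ‖E_{ij}(x)‖` is a lattice subsolution with source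
  `κ = 232(d−2)m²`: hypotheses = the lattice Yang–Mills equation at the four links of every plaquette `(x; i, j)`, `x ∈ I`
  (`covDiv = 0`; ⇔ criticality of the Wilson action there, `CovariantDivergenceEL.critical_iff_covDiv_eq_zero`) and the
  a-priori envelope «faces of the cubes above∕below these plaquettes have `Re ≥ 0` and sine-curvature `≤ m ≤ ½`»;
* **`exists_mem_layer_sineCurvature_le`** — (γ) sign-free: for `x₀ ∈ I` some `y ∈ layer I` (the outer neighbours of
  `I`) has `‖E_{ij}(x₀)‖ ≤ ‖E_{ij}(y)‖ + (232(d−2)m²∕2d)·|y − x₀|²`;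
* **`sineCurvature_le_layerMax`** — THE NET FORM (PH-k's conclusion for one orientation pair):
  `‖E_{ij}(x₀)‖ ≤ M + (232(d−2)m²∕2d)·D²` whenever `‖E_{ij}‖ ≤ M` on `layer I` and `layer I` lies within squared distance
  `D²` of `x₀` — «the overshoot of the maximum principle is `C_d·m²·D²`», with the explicit crude `C_d = 116(d−2)∕d`
  (`d = 4`: `58`).

WHAT THIS IS AND IS NOT (PRICING-NE7b v5 F23∕F23a∕F23b, ROUTES v5 (δ)). It is the law-free two-thirds of PH-k — a
statement about one configuration, conditional on the ENVELOPE `m` over `I`'s cube-neighbourhood, which is exactly the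
input the (δ) bootstrap ∕ PH-k″ continuity argument must supply (honest small parameter `κ_C = C_d·m²·D²`, i.e. `ε_k·D²`,
not `ε_k`; terminal clause `κ_C ≤ ¼` per F23a; below the clause the interior-free minimiser bifurcates, F23b). Nothing
here supplies that envelope, the look-in certification of `layer I`, the window clause, or anything of (MP<L²) beyond
this conditional inequality; nothing of [Bałaban 1983–89] is asserted or cited; the `specialUnitaryGroup (Fin 2) ℂ ≃`
unit-quaternion bridge is NOT formalised. NE7b (`T4WeightBudget.RelWeightBound`) NOT PRINTED, NOT PROVED; spine PROVED
0∕9; rung (B)+1 on a FINITE torus T⁴ — NOT infinite volume, NOT the mass gap, NOT Clay. HONEST DEPENDENCY: continuum YM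
on T⁴ ⇐ BetaPertH ∧ nine spine estimates (0/9 proved); BetaPertH ⇐ (D1) ∧ (D4) ∧ CAP+tail; G-an2-4 gates asym, D1 and
NE2/3/4. POLICY: crux-route work under `Spine/NE7b/` (FREEZE (0) respected: ROUTES v5's PH-k assembly, not a
`T4Continuum/Support` leaf, not a folklore-algebra module); 0 definitions, no `Prop` fact, no `[cite:]` fact.
-/

set_option autoImplicit false

namespace Summit.QuantumFields.BalabanUV.T4Continuum.NE7b.SineCurvatureMaximumPrinciple

noncomputable section

open scoped Quaternion
open Literature.MathematicalPhysics.QuantumFieldTheory (ZdEdge ZdGaugeConfig)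
open Literature.Probability.LatticeModels (Site)
open Summit.QuantumFields.BalabanUV.T4Continuum.NE7b.AbelianCurvatureMaximumPrinciple (e layer)
open Summit.QuantumFields.BalabanUV.T4Continuum.NE7b.LatticeSubsolutionBarrier (distSq barrier_subsolution
  barrier_subsolution_le)
open Summit.QuantumFields.BalabanUV.T4Continuum.NE7b.CovariantDivergenceEL (curv covDiv)
open Summit.QuantumFields.BalabanUV.T4Continuum.NE7b.CovariantMeanValueInequality (cubeFaces meanValue_inequality
  two_le_of_ne)

variable {d : ℕ}

/-- **THE SINE-CURVATURE IS A LATTICE SUBSOLUTION ON A CRITICAL REGION.** Fix directions `i ≠ j` and a finite set `I` of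
base points such that for every `x ∈ I` the four links of the plaquette `(x; i, j)` satisfy the lattice Yang–Mills
equation and the faces of the cubes above∕below it (all transverse directions) have `Re ≥ 0` and sine-curvature
`≤ m ≤ ½`. Then `s(x) := ‖E_{ij}(x)‖` satisfies `2d·s(x) ≤ Σ_{l,±} s(x ± e_l) + 232(d−2)m²` on `I` — the hypothesis of
the barrier lemma (γ). -/
theorem sineCurvature_subsolution (U : ZdGaugeConfig d (Metric.sphere (0 : ℍ) 1)) (i j : Fin d) (hij : i ≠ j)
    (I : Finset (Site d)) {m : ℝ} (hm : 0 ≤ m) (hm2 : m ≤ 1 / 2)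
    (hre : ∀ x ∈ I, ∀ k : Fin d, k ≠ i → k ≠ j →
      ∀ q ∈ cubeFaces U x i j k ++ cubeFaces U (x - Pi.single k 1) i j k, 0 ≤ (q : ℍ).re)
    (him : ∀ x ∈ I, ∀ k : Fin d, k ≠ i → k ≠ j →
      ∀ q ∈ cubeFaces U x i j k ++ cubeFaces U (x - Pi.single k 1) i j k, ‖(q : ℍ).im‖ ≤ m)
    (hEL : ∀ x ∈ I, covDiv U x i = 0 ∧ covDiv U x j = 0 ∧ covDiv U (x + Pi.single j 1) i = 0 ∧
      covDiv U (x + Pi.single i 1) j = 0) :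
    ∀ x ∈ I, 2 * (d : ℝ) * ‖curv U x i j‖ ≤
      (∑ l : Fin d, (‖curv U (x + e l) i j‖ + ‖curv U (x - e l) i j‖)) + 232 * ((d : ℝ) - 2) * m ^ 2 := by
  intro x hx
  obtain ⟨h1, h2, h3, h4⟩ := hEL x hx
  exact meanValue_inequality U x i j hij hm hm2 (hre x hx) (him x hx) h1 h2 h3 h4

/-- **PH-k, SIGN-FREE FORM ((β₄)+(γ)).** Under the hypotheses of `sineCurvature_subsolution` (and `d ≥ 1`), for every
`x₀ ∈ I` there is an outer neighbour `y ∈ layer I` with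
`‖E_{ij}(x₀)‖ ≤ ‖E_{ij}(y)‖ + (232(d−2)m² ∕ 2d)·|y − x₀|²`. -/
theorem exists_mem_layer_sineCurvature_le (hd : 0 < d) (U : ZdGaugeConfig d (Metric.sphere (0 : ℍ) 1)) (i j : Fin d)
    (hij : i ≠ j) (I : Finset (Site d)) {m : ℝ} (hm : 0 ≤ m) (hm2 : m ≤ 1 / 2)
    (hre : ∀ x ∈ I, ∀ k : Fin d, k ≠ i → k ≠ j →
      ∀ q ∈ cubeFaces U x i j k ++ cubeFaces U (x - Pi.single k 1) i j k, 0 ≤ (q : ℍ).re)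
    (him : ∀ x ∈ I, ∀ k : Fin d, k ≠ i → k ≠ j →
      ∀ q ∈ cubeFaces U x i j k ++ cubeFaces U (x - Pi.single k 1) i j k, ‖(q : ℍ).im‖ ≤ m)
    (hEL : ∀ x ∈ I, covDiv U x i = 0 ∧ covDiv U x j = 0 ∧ covDiv U (x + Pi.single j 1) i = 0 ∧
      covDiv U (x + Pi.single i 1) j = 0)
    {x₀ : Site d} (hx₀ : x₀ ∈ I) :
    ∃ y ∈ layer I, ‖curv U x₀ i j‖ ≤ ‖curv U y i j‖ + (232 * ((d : ℝ) - 2) * m ^ 2) / (2 * d) * distSq x₀ y :=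
  barrier_subsolution hd (s := fun x => ‖curv U x i j‖) (sineCurvature_subsolution U i j hij I hm hm2 hre him hEL) hx₀

/-- **PH-k, NET FORM — THE APPROXIMATE MAXIMUM PRINCIPLE FOR THE SINE-CURVATURE ((β₄)+(γ)).** Under the hypotheses of
`sineCurvature_subsolution` (and `d ≥ 1`): if `‖E_{ij}‖ ≤ M` on `layer I` and every point of `layer I` is within squared
lattice distance `D²` of `x₀ ∈ I`, then `‖E_{ij}(x₀)‖ ≤ M + (232(d−2)m² ∕ 2d)·D²` — the interior sine-curvature exceeds
its maximum over the outer layer by at most `C_d·m²·D²` («the overshoot is governed by the DEPTH of `x₀` in `I`»; v5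
(δ): the honest small parameter is `m·D`, not `m`). -/
theorem sineCurvature_le_layerMax (hd : 0 < d) (U : ZdGaugeConfig d (Metric.sphere (0 : ℍ) 1)) (i j : Fin d)
    (hij : i ≠ j) (I : Finset (Site d)) {m M D2 : ℝ} (hm : 0 ≤ m) (hm2 : m ≤ 1 / 2)
    (hre : ∀ x ∈ I, ∀ k : Fin d, k ≠ i → k ≠ j →
      ∀ q ∈ cubeFaces U x i j k ++ cubeFaces U (x - Pi.single k 1) i j k, 0 ≤ (q : ℍ).re)
    (him : ∀ x ∈ I, ∀ k : Fin d, k ≠ i → k ≠ j →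
      ∀ q ∈ cubeFaces U x i j k ++ cubeFaces U (x - Pi.single k 1) i j k, ‖(q : ℍ).im‖ ≤ m)
    (hEL : ∀ x ∈ I, covDiv U x i = 0 ∧ covDiv U x j = 0 ∧ covDiv U (x + Pi.single j 1) i = 0 ∧
      covDiv U (x + Pi.single i 1) j = 0)
    (hM : ∀ y ∈ layer I, ‖curv U y i j‖ ≤ M) {x₀ : Site d} (hx₀ : x₀ ∈ I)
    (hD : ∀ y ∈ layer I, distSq x₀ y ≤ D2) :
    ‖curv U x₀ i j‖ ≤ M + (232 * ((d : ℝ) - 2) * m ^ 2) / (2 * d) * D2 := by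
  have hd2 : (2 : ℝ) ≤ d := by exact_mod_cast two_le_of_ne i j hij
  have hκ : 0 ≤ 232 * ((d : ℝ) - 2) * m ^ 2 := by
    have : 0 ≤ (d : ℝ) - 2 := by linarith
    positivity
  exact barrier_subsolution_le hd (s := fun x => ‖curv U x i j‖) hκ
    (sineCurvature_subsolution U i j hij I hm hm2 hre him hEL) hx₀ hM hD

end

end Summit.QuantumFields.BalabanUV.T4Continuum.NE7b.SineCurvatureMaximumPrinciple
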